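import Summits.BirchSwinnertonDyer.BirchSwinnertonDyer.Theorems.AlignedTransportAtTwoMainConjectureOfRankZeroBSDAtTwoCyclotomicLayerRankGrowth
import Summits.BirchSwinnertonDyer.BirchSwinnertonDyer.Theorems.AlignedTransportAtTwoMainConjectureOfRankZeroBSDAtTwoLayerOneRankBound
import Summits.BirchSwinnertonDyer.BirchSwinnertonDyer.Theorems.AlignedTransportAtTwoMainConjectureOfRankZeroBSDAtTwoEisensteinRigidityPrime
import HarnessLib

/-!
# Route `AlignedTransportAtTwo`, crux C2 `MainConjectureOfRankZeroBSDAtTwo` (stmt-BirchSwinnertonDyer-22298):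
# THE RANK DOOR OF THE `a₂ = +1` ROAD MADE KERNEL — a Mordell–Weil jump by `2ⁿ` in the layer `ℚ_{n+1}/ℚ_n` of the cyclotomic `ℤ₂`-tower
# (`n ≥ 1`) forces `Φ_{2^{n+1}}(1+T) ~ H`, hence `λ₂(W) = 2ⁿ + 1`; `rank W(ℚ₂) ≥ 3 ⇒ λ₂ = 3`; `λ₂ ≠ 2ⁿ + 1 ⇒` no such jump

HONEST FRAMING (cell `bsd-f1-sign2`, WIDTH-5 attached prover seat `bsd-line-att-p5` gen 36 on line `birth` of the lead `bsd-line-att-p2`;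
`--supports` stmt-BirchSwinnertonDyer-22298, closes nothing; BSD is NOT proved by any of this; the crux C2, its verdict «blocked-on
`Rank1Residual.GreenbergMuConjectureIrreducible`» and every registered stub are untouched). THEOREMS ONLY — no `def`, no `sorry`, nothing
asserted about any particular curve. The ONE print binder is the lineage's `h17` = Kato 2004 Thm. 17.4 (1)(2) AT `2` (`kato_divisibility_allPrimes W 2`);
§3 adds `hGZK` (Gross–Zagier–Kolyvagin, to read `rank W(ℚ) = 0` from `r_an = 0` via the g34 bound `rank W(ℚ₁) ≤ 1`).

THE POINT (EISENSTEIN-RIGIDITY memo §3 (3) «RANK DOOR (pen, sharp)», made kernel). On the `a₂ = +1` road (`W` globally minimal, good ordinary at `2`,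
`a₂ = +1`, `∏ c_v` odd, `Δ_min ≡ 3,5 (8)`, `r_an = 0`, `‖[0]⁺_f‖₂ = 1`, `μ(L₀) = 0`) the integral `2`-adic `L`-function is `L₀ = (T+2)·H` with `H`
EISENSTEIN (g33), hence PRIME in `Λ` (g35 `prime_of_norm_constantCoeff_eq_half`), and Kato gives `f_X · a = 2ᵐ·(T+2)·H` (g34 `charGen_shape_of_road`).
By the layer theorem of this gen (`cyclotomicLayer_pow_dvd_of_charIdeal_eq_span_of_rank_le`, p = 2: `φ(2^{n+1}) = 2ⁿ`), a jump
`rank W(ℚ_{n+1}) ≥ rank W(ℚ_n) + 2ⁿ` puts the PRIME `Ψ_n = Φ_{2^{n+1}}(1+T)` (`λ(Ψ_n) = 2ⁿ`) into `f_X`, so `Ψ_n ∣ 2ᵐ·(T+2)·H`; `Ψ_n ∤ 2ᵐ`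
(`λ = 0`), `Ψ_n ∤ (T+2)` for `n ≥ 1` (`λ = 1`), hence `Ψ_n ∣ H`, and `H` prime forces `H ~ Ψ_n`: **`λ₂ − 1 = λ(H) = 2ⁿ`**.

* §1 (pure `Λ`-algebra) `lam_eq_of_prime_dvd_C_mul_X_add_C_two_mul` — `P, H` prime, `λ(P) ≥ 2`, `P ∣ 2ᵐ·(T+2)·H ⇒ λ(H) = λ(P)`.
* §2 ★ `lam_eq_two_pow_add_one_of_road_of_cyclotomicLayer_dvd` (`Φ_{2^{n+1}}(1+T) ∣ f_X` at one datum, `n ≥ 1 ⇒ λ₂ = 2ⁿ + 1`) and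
  ★★ `lam_eq_two_pow_add_one_of_road_of_rank_jump` — on the `a₂ = +1` road, at the cyclotomic `ℤ₂`-tower with normalised generator:
  **`n ≥ 1`, `rank W(ℚ_n) + 2ⁿ ≤ rank W(ℚ_{n+1}) ⇒ λ(L₀) = 2ⁿ + 1`**; contrapositive `mordellWeilRank_layer_succ_lt_of_lam_ne` —
  **`λ₂ ≠ 2ⁿ + 1 ⇒ rank W(ℚ_{n+1}) < rank W(ℚ_n) + 2ⁿ`** (so for `λ₂ ∈ {7, 11, 15}` — 3547, 139/5579, 2515 in the cell's census — NO layer of the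
  `2`-tower sees a full new Galois orbit of points).
* §3 (`+ hGZK`) ★ `lam_eq_three_of_road_of_mordellWeilRank_layer_two` — **`rank W(ℚ₂) ≥ 3 ⇒ λ₂ = 3`** (`rank W(ℚ₁) ≤ 1`, g34); typed-certificate form
  `lam_eq_three_of_road_of_layerRankGEAt_two_three` (**`Iwasawa.LayerRankGEAt W 2 2 3 ⇒ λ₂ = 3`**, g34 memo §4 (iii) verbatim) and the refutation
  `not_layerRankGEAt_two_three_of_lam_ne_three` (**`λ₂ ≠ 3 ⇒ ¬ LayerRankGEAt W 2 2 3`**, i.e. `rank W(ℚ(ζ₁₆)⁺) ≤ 2`).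

References: R. Greenberg, LNM 1716 (1999), Thm. 1.9 (p. 63), §5 p. 132 (conductor 34: «`θ_1^t` divides `f_E(T)`») and p. 177 (conductor 195:
`g = (T+2)(T²+2T+2)`) [GreenbergLNM1716]; K. Kato, Astérisque 295 (2004), Thm. 17.4 [Kato2004Asterisque]; L. Washington, GTM 83, §7.1, §13.2 [Washington1997].
-/

set_option linter.dupNamespace false
set_option autoImplicit false

noncomputable section

open scoped Classical MatrixGroups ModularForm Polynomial

namespace Summit.BirchSwinnertonDyer.BirchSwinnertonDyer.Theorems.AlignedTransportAtTwoCyclotomicLayerRoad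

open PowerSeries CongruenceSubgroup WeierstrassCurve Literature.NumberTheory.EllipticCurves
  Literature.NumberTheory.EllipticCurves.ModularForms
  Literature.NumberTheory.EllipticCurves.Rank1Residual
  Literature.NumberTheory.EllipticCurves.Rank1Residual.Typed
  Literature.NumberTheory.EllipticCurves.Greenberg1999
  Summit.BirchSwinnertonDyer.Rank1Residual
  Summit.BirchSwinnertonDyer.Rank1Residual.X1.MuLambda
  Summit.BirchSwinnertonDyer.Rank1Residual.X1.MuPart
  Summit.BirchSwinnertonDyer.Rank1Residual.X1.ParitySqueeze
  Summit.BirchSwinnertonDyer.Rank1Residual.X5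
  Summit.BirchSwinnertonDyer.Rank1Residual.F1Sign2
  Summit.BirchSwinnertonDyer.Rank1Residual.Iwasawa
  Summit.BirchSwinnertonDyer.BirchSwinnertonDyer.Theorems.Rank1ResidualX1Defs
  Summit.BirchSwinnertonDyer.BirchSwinnertonDyer.Theorems.AlignedTransportAtTwoSeed
  Summit.BirchSwinnertonDyer.BirchSwinnertonDyer.Theorems.AlignedTransportAtTwoSeedLambdaCell
  Summit.BirchSwinnertonDyer.BirchSwinnertonDyer.Theorems.AlignedTransportAtTwoTwoFixedPoints
  Summit.BirchSwinnertonDyer.BirchSwinnertonDyer.Theorems.AlignedTransportAtTwoRoadSecondFixedPoint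
  Summit.BirchSwinnertonDyer.BirchSwinnertonDyer.Theorems.AlignedTransportAtTwoEisensteinRigidity
  Summit.BirchSwinnertonDyer.BirchSwinnertonDyer.Theorems.AlignedTransportAtTwoEisensteinRigidityRoad
  Summit.BirchSwinnertonDyer.BirchSwinnertonDyer.Theorems.AlignedTransportAtTwoEisensteinRigidityPrime
  Summit.BirchSwinnertonDyer.BirchSwinnertonDyer.Theorems.AlignedTransportAtTwoLayerOneRankBound
  Summit.BirchSwinnertonDyer.BirchSwinnertonDyer.Theorems.AlignedTransportAtTwoCyclotomicLayerPrime
  Summit.BirchSwinnertonDyer.BirchSwinnertonDyer.Theorems.AlignedTransportAtTwoCyclotomicLayerRankGrowth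
  Summit.BirchSwinnertonDyer.BirchSwinnertonDyer.Theorems.DefectPrime

/-! ## §1 Pure `Λ`-algebra: a prime of `λ ≥ 2` dividing `2ᵐ·(T+2)·H` with `H` prime has `λ(H) = λ(P)` -/

/-- **`P, H` prime in `Λ = ℤ₂⟦T⟧`, `λ(P) ≥ 2`, `P ∣ 2ᵐ·(T+2)·H ⇒ λ(H) = λ(P)`**: `P ∤ 2ᵐ` (`λ(2ᵐ) = 0`) and `P ∤ T+2` (`λ(T+2) = 1`; a divisor has
smaller `λ`), so `P ∣ H`; `H` prime is irreducible, so `H = P·u` with `u` a unit and `λ(H) = λ(P)`. [cite: Washington1997, §7.1 and §13.2] -/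
theorem lam_eq_of_prime_dvd_C_mul_X_add_C_two_mul {P H : PowerSeries ℤ_[2]} (hP : Prime P) (hlP : 2 ≤ lam P) (hH : Prime H)
    {m : ℕ} (hdvd : P ∣ C ((2 : ℤ_[2]) ^ m) * ((X + C (2 : ℤ_[2])) * H)) : lam H = lam P := by
  have hP0 : P ≠ 0 := hP.ne_zero
  -- a divisor of a nonzero `G` has `λ ≤ λ(G)`
  have hle : ∀ {G : PowerSeries ℤ_[2]}, G ≠ 0 → P ∣ G → lam P ≤ lam G := by
    intro G hG0 h
    obtain ⟨q, rfl⟩ := h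
    have hq0 : q ≠ 0 := by rintro rfl; exact hG0 (mul_zero _)
    rw [lam_mul hP0 hq0]; exact Nat.le_add_right _ _
  rcases hP.dvd_or_dvd hdvd with h2 | hXH
  · -- `P ∣ 2ᵐ`: impossible, `λ(2ᵐ) = 0`
    exfalso
    have h0 : lam (C ((2 : ℤ_[2]) ^ m) : PowerSeries ℤ_[2]) = 0 := by
      have := (lam_mu_norm_C_pow (p := 2) m).1
      exact_mod_cast this
    have hC0 : (C ((2 : ℤ_[2]) ^ m) : PowerSeries ℤ_[2]) ≠ 0 := by
      rw [Ne, map_eq_zero_iff _ (C_injective (R := ℤ_[2]))]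
      exact pow_ne_zero _ two_ne_zero
    have := hle hC0 h2
    omega
  rcases hP.dvd_or_dvd hXH with hX | hHd
  · -- `P ∣ T+2`: impossible, `λ(T+2) = 1`
    exfalso
    have := hle prime_X_add_C_two.ne_zero hX
    rw [lam_X_add_C_two] at this
    omega
  · -- `P ∣ H`, `H` irreducible
    obtain ⟨u, hu⟩ := hHd
    have hunit : IsUnit u := by
      rcases hH.irreducible.isUnit_or_isUnit hu with hPu | huu
      · exact absurd hPu hP.not_unit
      · exact huu
    have hu0 : u ≠ 0 := hunit.ne_zero
    rw [hu, lam_mul hP0 hu0, AlignedTransportAtTwoEisensteinRigidity.lam_eq_zero_of_isUnit hunit, add_zero]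

/-! ## §2 On the `a₂ = +1` road: a jump by `2ⁿ` in the layer `ℚ_{n+1}/ℚ_n` (`n ≥ 1`) forces `λ₂ = 2ⁿ + 1` -/

variable (W : WeierstrassCurve ℚ) [W.IsElliptic] [W.IsGloballyMinimal]

/-- ★ **`Φ_{2^{n+1}}(1+T) ∣ f_X` AT ONE CYCLOTOMIC DATUM (`n ≥ 1`) FORCES `λ₂ = 2ⁿ + 1` on the `a₂ = +1` road.** Road hypotheses as in
`charGen_shape_of_road` (PRINT `h17`); `D` a dual datum at the cyclotomic `κ, γ` with `char_Λ X = (f_X)`. If the layer prime `Φ_{2^{n+1}}(1+T)` (`λ = 2ⁿ`)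
divides `f_X`, then `Φ ∣ 2ᵐ·(T+2)·H` (Kato) with `H` the prime Eisenstein cofactor of `L₀ = (T+2)·H`, so `H ~ Φ` (§1) and `λ(G) = 2ⁿ + 1`. The divisibility
is supplied by a rank jump (`lam_eq_two_pow_add_one_of_road_of_rank_jump`) or by the kernel lattice of the relative norm (companion `…RankDichotomy`).
[cite: Kato2004Asterisque, Thm. 17.4 (1)(2) (p. 273)] [cite: GreenbergLNM1716, §5 p. 132 and p. 177] -/
theorem lam_eq_two_pow_add_one_of_road_of_cyclotomicLayer_dvd [NeZero (W.conductorNorm ℤ)] {f : CuspForm (Gamma0 (W.conductorNorm ℤ)) 2}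
    (h17 : kato_divisibility_allPrimes W 2 (f := f)) (hord : IsOrdinaryAt W 2) (hf : IsNewformOf W f)
    (ha : W.frobeniusTrace 2 = 1) (hodd : Odd W.tamagawaProduct)
    (hΔ : minimalDiscriminantInt W % 8 = 3 ∨ minimalDiscriminantInt W % 8 = 5) (hr : W.analyticRank = 0)
    {G : IwasawaAlgebra 2} (hG : iwasawaToPowerSeries 2 G = padicLFunction f (unitRoot W 2 : ℚ_[2]))
    (hμ : mu G = 0) (hsym : ‖(ratPlusSymbol f 0 : ℚ_[2])‖ = 1)
    {κ : ZpExtension ℚ 2} {γ : Field.absoluteGaloisGroup ℚ} (hκ : κ.IsCyclotomic) (hγ : κ.IsTopGenerator γ)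
    (hγ' : IsCyclotomicVariable 2 γ) (D : W.SelmerDualData κ γ) {fX : IwasawaAlgebra 2} (hchar : D.charIdeal = Ideal.span {fX})
    {n : ℕ} (hn : 1 ≤ n)
    (hdvd : (((Polynomial.cyclotomic (2 ^ (n + 1)) ℤ_[2]).comp (Polynomial.X + 1) : ℤ_[2][X]) : PowerSeries ℤ_[2]) ∣ fX) :
    lam G = 2 ^ n + 1 := by
  obtain ⟨-, -, -, -, H, a, m, -, hHn, -, -, -, hlamG, hrel⟩ :=
    charGen_shape_of_road W h17 hord hf ha hodd hΔ hr hG hμ hsym hκ hγ hγ' D hchar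
  have hdvd' : (((Polynomial.cyclotomic (2 ^ (n + 1)) ℤ_[2]).comp (Polynomial.X + 1) : ℤ_[2][X]) : PowerSeries ℤ_[2]) ∣
      C ((2 : ℤ_[2]) ^ m) * ((X + C (2 : ℤ_[2])) * H) := by
    have h : (((2 : ℕ) : ℤ_[2]) ^ m) = (2 : ℤ_[2]) ^ m := by push_cast; rfl
    rw [← h, ← hrel]
    exact dvd_mul_of_dvd_left hdvd a
  -- `λ(Φ_{2^{n+1}}(1+T)) = 2ⁿ ≥ 2`, both `Φ` and `H` prime
  have hlamΦ : lam ((((Polynomial.cyclotomic (2 ^ (n + 1)) ℤ_[2]).comp (Polynomial.X + 1) : ℤ_[2][X]) : PowerSeries ℤ_[2])) = 2 ^ n := by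
    rw [lam_cyclotomicLayer]; simp
  have h2 : 2 ≤ lam ((((Polynomial.cyclotomic (2 ^ (n + 1)) ℤ_[2]).comp (Polynomial.X + 1) : ℤ_[2][X]) : PowerSeries ℤ_[2])) := by
    rw [hlamΦ]
    calc 2 = 2 ^ 1 := (pow_one 2).symm
      _ ≤ 2 ^ n := Nat.pow_le_pow_right two_pos hn
  have hHprime : Prime H := prime_of_norm_constantCoeff_eq_half hHn
  have hlamH := lam_eq_of_prime_dvd_C_mul_X_add_C_two_mul (prime_coe_cyclotomic_comp 2 n) h2 hHprime hdvd'
  rw [hlamG, hlamH, hlamΦ]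

/-- ★★ **A MORDELL–WEIL JUMP BY `2ⁿ` IN THE LAYER `ℚ_{n+1}/ℚ_n` (`n ≥ 1`) FORCES `λ₂ = 2ⁿ + 1`.** `W/ℚ` globally minimal, good ordinary at `2`, `a₂ = +1`,
`∏ c_v` odd, `Δ_min ≡ 3, 5 (mod 8)`, `r_an = 0`; `f` its newform at level `N_W` with `‖[0]⁺_f‖₂ = 1`; `G` an integral lift of `L₂(f,α)` with `μ(G) = 0`;
PRINT `h17` (Kato 17.4 (1)(2) at `2`); `κ` the cyclotomic `ℤ₂`-extension with normalised topological generator `γ`. If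
**`rank_ℤ W(ℚ_n) + 2ⁿ ≤ rank_ℤ W(ℚ_{n+1})`** for some `n ≥ 1`, then **`λ(G) = 2ⁿ + 1`**: the jump puts the prime `Φ_{2^{n+1}}(1+T)` (of `λ = 2ⁿ`) into
`f_X ∣ 2ᵐ·(T+2)·H` (Kato), and the Eisenstein cofactor `H` of `L₀ = (T+2)·H` is prime, so `H ~ Φ_{2^{n+1}}(1+T)` (§1). Greenberg's conductor-195 shape
`(T+2)(T²+2T+2)` (p. 177) is the case `n = 1`. [cite: Kato2004Asterisque, Thm. 17.4 (1)(2) (p. 273)] [cite: GreenbergLNM1716, §5 p. 132 and p. 177] -/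
theorem lam_eq_two_pow_add_one_of_road_of_rank_jump [NeZero (W.conductorNorm ℤ)] {f : CuspForm (Gamma0 (W.conductorNorm ℤ)) 2}
    (h17 : kato_divisibility_allPrimes W 2 (f := f)) (hord : IsOrdinaryAt W 2) (hf : IsNewformOf W f)
    (ha : W.frobeniusTrace 2 = 1) (hodd : Odd W.tamagawaProduct)
    (hΔ : minimalDiscriminantInt W % 8 = 3 ∨ minimalDiscriminantInt W % 8 = 5) (hr : W.analyticRank = 0)
    {G : IwasawaAlgebra 2} (hG : iwasawaToPowerSeries 2 G = padicLFunction f (unitRoot W 2 : ℚ_[2]))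
    (hμ : mu G = 0) (hsym : ‖(ratPlusSymbol f 0 : ℚ_[2])‖ = 1)
    {κ : ZpExtension ℚ 2} {γ : Field.absoluteGaloisGroup ℚ} (hκ : κ.IsCyclotomic) (hγ : κ.IsTopGenerator γ)
    (hγ' : IsCyclotomicVariable 2 γ) {n : ℕ} (hn : 1 ≤ n)
    (hjump : (W.baseChange (κ.layer n)).mordellWeilRank + 2 ^ n ≤ (W.baseChange (κ.layer (n + 1))).mordellWeilRank) :
    lam G = 2 ^ n + 1 := by
  obtain ⟨D⟩ := W.nonempty_selmerDualData_holds κ γ hγ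
  haveI : Module.Finite (IwasawaAlgebra 2) D.X := D.module_finite_holds hγ
  haveI : (Module.charIdeal (IwasawaAlgebra 2) D.X).IsPrincipal := charIdeal_isPrincipal_holds 2 D.X
  obtain ⟨fX, hfX⟩ := Submodule.IsPrincipal.principal (Module.charIdeal (IwasawaAlgebra 2) D.X)
  have hchar : D.charIdeal = Ideal.span {fX} := hfX
  have hD : D.IsTorsion := (charGen_shape_of_road W h17 hord hf ha hodd hΔ hr hG hμ hsym hκ hγ hγ' D hchar).1
  -- the layer theorem at `p = 2`: `Φ_{2^{n+1}}(1+T) ∣ f_X`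
  have hle : (W.baseChange (κ.layer n)).mordellWeilRank + 2 ^ n * (2 - 1) * 1 ≤ (W.baseChange (κ.layer (n + 1))).mordellWeilRank := by
    simpa using hjump
  have hdvd := cyclotomicLayer_pow_dvd_of_charIdeal_eq_span_of_rank_le W hγ D hD hchar n hle
  rw [pow_one] at hdvd
  exact lam_eq_two_pow_add_one_of_road_of_cyclotomicLayer_dvd W h17 hord hf ha hodd hΔ hr hG hμ hsym hκ hγ hγ' D hchar hn hdvd

/-- **Contrapositive: `λ₂ ≠ 2ⁿ + 1` (`n ≥ 1`) ⇒ `rank W(ℚ_{n+1}) < rank W(ℚ_n) + 2ⁿ`** — the layer `ℚ_{n+1}/ℚ_n` does NOT acquire a full new Galois orbit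
of independent points (`φ(2^{n+1}) = 2ⁿ` of them). For `λ₂ − 1` not a power of two (`λ₂ ∈ {7, 11, 15}`: 3547, 139, 5579, 2515 in the cell's census) this
holds at EVERY layer `n ≥ 1`. [cite: Kato2004Asterisque, Thm. 17.4 (1)(2) (p. 273)] [cite: GreenbergLNM1716, §5 p. 132] -/
theorem mordellWeilRank_layer_succ_lt_of_lam_ne [NeZero (W.conductorNorm ℤ)] {f : CuspForm (Gamma0 (W.conductorNorm ℤ)) 2}
    (h17 : kato_divisibility_allPrimes W 2 (f := f)) (hord : IsOrdinaryAt W 2) (hf : IsNewformOf W f)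
    (ha : W.frobeniusTrace 2 = 1) (hodd : Odd W.tamagawaProduct)
    (hΔ : minimalDiscriminantInt W % 8 = 3 ∨ minimalDiscriminantInt W % 8 = 5) (hr : W.analyticRank = 0)
    {G : IwasawaAlgebra 2} (hG : iwasawaToPowerSeries 2 G = padicLFunction f (unitRoot W 2 : ℚ_[2]))
    (hμ : mu G = 0) (hsym : ‖(ratPlusSymbol f 0 : ℚ_[2])‖ = 1)
    {κ : ZpExtension ℚ 2} {γ : Field.absoluteGaloisGroup ℚ} (hκ : κ.IsCyclotomic) (hγ : κ.IsTopGenerator γ)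
    (hγ' : IsCyclotomicVariable 2 γ) {n : ℕ} (hn : 1 ≤ n) (hl : lam G ≠ 2 ^ n + 1) :
    (W.baseChange (κ.layer (n + 1))).mordellWeilRank < (W.baseChange (κ.layer n)).mordellWeilRank + 2 ^ n := by
  by_contra hge
  exact hl (lam_eq_two_pow_add_one_of_road_of_rank_jump W h17 hord hf ha hodd hΔ hr hG hμ hsym hκ hγ hγ' hn (not_lt.mp hge))

/-! ## §3 The second layer: `rank W(ℚ₂) ≥ 3 ⇒ λ₂ = 3`; the typed certificate `LayerRankGEAt W 2 2 3` -/

/-- ★ **`rank W(ℚ₂) ≥ 3 ⇒ λ₂ = 3` on the `a₂ = +1` road** (`+ hGZK`: `rank W(ℚ) = 0` from `r_an = 0`, so `rank W(ℚ₁) ≤ 1` by the g34 bound at the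
second fixed point; then the layer `ℚ₂/ℚ₁` jumps by `≥ 2 = φ(4)` and §2 applies with `n = 1`): `char X ∋ Φ₄(1+T)·(T+2) = (T²+2T+2)(T+2)` — Greenberg's
conductor-195 shape. [cite: Kato2004Asterisque, Thm. 17.4 (1)(2) (p. 273)] [cite: GreenbergLNM1716, §5 p. 177] -/
theorem lam_eq_three_of_road_of_mordellWeilRank_layer_two [NeZero (W.conductorNorm ℤ)] {f : CuspForm (Gamma0 (W.conductorNorm ℤ)) 2}
    (h17 : kato_divisibility_allPrimes W 2 (f := f)) (hGZK : rank_eq_analyticRank_of_analyticRank_le_one)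
    (hord : IsOrdinaryAt W 2) (hf : IsNewformOf W f) (ha : W.frobeniusTrace 2 = 1) (hodd : Odd W.tamagawaProduct)
    (hΔ : minimalDiscriminantInt W % 8 = 3 ∨ minimalDiscriminantInt W % 8 = 5) (hr : W.analyticRank = 0)
    {G : IwasawaAlgebra 2} (hG : iwasawaToPowerSeries 2 G = padicLFunction f (unitRoot W 2 : ℚ_[2]))
    (hμ : mu G = 0) (hsym : ‖(ratPlusSymbol f 0 : ℚ_[2])‖ = 1)
    {κ : ZpExtension ℚ 2} {γ : Field.absoluteGaloisGroup ℚ} (hκ : κ.IsCyclotomic) (hγ : κ.IsTopGenerator γ)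
    (hγ' : IsCyclotomicVariable 2 γ) (h3 : 3 ≤ (W.baseChange (κ.layer 2)).mordellWeilRank) : lam G = 3 := by
  have h1 : (W.baseChange (κ.layer 1)).mordellWeilRank ≤ 1 :=
    mordellWeilRank_layer_one_le_one_of_road W h17 hGZK hord hf ha hodd hΔ hr hG hsym hκ hγ hγ'
  have h3' : 3 ≤ (W.baseChange (κ.layer (1 + 1))).mordellWeilRank := h3
  have h := lam_eq_two_pow_add_one_of_road_of_rank_jump W h17 hord hf ha hodd hΔ hr hG hμ hsym hκ hγ hγ' (n := 1) le_rfl (by omega)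
  simpa using h

/-- ★ **THE TYPED CERTIFICATE `Iwasawa.LayerRankGEAt W 2 2 3` FORCES `λ₂ = 3`** on the `a₂ = +1` road (EISENSTEIN-RIGIDITY memo §4 (iii), verbatim):
read at the normalised cyclotomic datum, which exists (`exists_isCyclotomic_isTopGenerator_isCyclotomicVariable_holds`). Combined with the lineage's
`mazurMainConjecture_two_of_road_of_layerRankGEAt_two` the same certificate also gives `MazurMainConjecture W 2`; the new content here is the RIGIDITY of `λ₂`.
[cite: Kato2004Asterisque, Thm. 17.4 (1)(2) (p. 273)] [cite: GreenbergLNM1716, §5 p. 177] -/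
theorem lam_eq_three_of_road_of_layerRankGEAt_two_three [NeZero (W.conductorNorm ℤ)] {f : CuspForm (Gamma0 (W.conductorNorm ℤ)) 2}
    (h17 : kato_divisibility_allPrimes W 2 (f := f)) (hGZK : rank_eq_analyticRank_of_analyticRank_le_one)
    (hord : IsOrdinaryAt W 2) (hf : IsNewformOf W f) (ha : W.frobeniusTrace 2 = 1) (hodd : Odd W.tamagawaProduct)
    (hΔ : minimalDiscriminantInt W % 8 = 3 ∨ minimalDiscriminantInt W % 8 = 5) (hr : W.analyticRank = 0)
    {G : IwasawaAlgebra 2} (hG : iwasawaToPowerSeries 2 G = padicLFunction f (unitRoot W 2 : ℚ_[2]))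
    (hμ : mu G = 0) (hsym : ‖(ratPlusSymbol f 0 : ℚ_[2])‖ = 1) (hrk : LayerRankGEAt W 2 2 3) : lam G = 3 := by
  obtain ⟨κ, hκ, γ, hγ, hγ'⟩ := exists_isCyclotomic_isTopGenerator_isCyclotomicVariable_holds 2
  exact lam_eq_three_of_road_of_mordellWeilRank_layer_two W h17 hGZK hord hf ha hodd hΔ hr hG hμ hsym hκ hγ hγ' (hrk κ hκ)

/-- **`λ₂ ≠ 3 ⇒ rank W(ℚ₂) ≤ 2`** on the `a₂ = +1` road (`ℚ₂ = ℚ(ζ₁₆)⁺`, the second layer of the cyclotomic `ℤ₂`-tower), at the normalised cyclotomic datum.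
[cite: Kato2004Asterisque, Thm. 17.4 (1)(2) (p. 273)] [cite: GreenbergLNM1716, §5 p. 177] -/
theorem mordellWeilRank_layer_two_le_two_of_road_of_lam_ne_three [NeZero (W.conductorNorm ℤ)] {f : CuspForm (Gamma0 (W.conductorNorm ℤ)) 2}
    (h17 : kato_divisibility_allPrimes W 2 (f := f)) (hGZK : rank_eq_analyticRank_of_analyticRank_le_one)
    (hord : IsOrdinaryAt W 2) (hf : IsNewformOf W f) (ha : W.frobeniusTrace 2 = 1) (hodd : Odd W.tamagawaProduct)
    (hΔ : minimalDiscriminantInt W % 8 = 3 ∨ minimalDiscriminantInt W % 8 = 5) (hr : W.analyticRank = 0)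
    {G : IwasawaAlgebra 2} (hG : iwasawaToPowerSeries 2 G = padicLFunction f (unitRoot W 2 : ℚ_[2]))
    (hμ : mu G = 0) (hsym : ‖(ratPlusSymbol f 0 : ℚ_[2])‖ = 1)
    {κ : ZpExtension ℚ 2} {γ : Field.absoluteGaloisGroup ℚ} (hκ : κ.IsCyclotomic) (hγ : κ.IsTopGenerator γ)
    (hγ' : IsCyclotomicVariable 2 γ) (hl : lam G ≠ 3) : (W.baseChange (κ.layer 2)).mordellWeilRank ≤ 2 := by
  by_contra hlt
  exact hl (lam_eq_three_of_road_of_mordellWeilRank_layer_two W h17 hGZK hord hf ha hodd hΔ hr hG hμ hsym hκ hγ hγ' (by omega))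

/-- **`λ₂ ≠ 3 ⇒ ¬ Iwasawa.LayerRankGEAt W 2 2 3`** on the `a₂ = +1` road: the rank-three-at-layer-two certificate is REFUTED unless `λ₂ = 3`.
[cite: Kato2004Asterisque, Thm. 17.4 (1)(2) (p. 273)] [cite: GreenbergLNM1716, §5 p. 177] -/
theorem not_layerRankGEAt_two_three_of_lam_ne_three [NeZero (W.conductorNorm ℤ)] {f : CuspForm (Gamma0 (W.conductorNorm ℤ)) 2}
    (h17 : kato_divisibility_allPrimes W 2 (f := f)) (hGZK : rank_eq_analyticRank_of_analyticRank_le_one)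
    (hord : IsOrdinaryAt W 2) (hf : IsNewformOf W f) (ha : W.frobeniusTrace 2 = 1) (hodd : Odd W.tamagawaProduct)
    (hΔ : minimalDiscriminantInt W % 8 = 3 ∨ minimalDiscriminantInt W % 8 = 5) (hr : W.analyticRank = 0)
    {G : IwasawaAlgebra 2} (hG : iwasawaToPowerSeries 2 G = padicLFunction f (unitRoot W 2 : ℚ_[2]))
    (hμ : mu G = 0) (hsym : ‖(ratPlusSymbol f 0 : ℚ_[2])‖ = 1) (hl : lam G ≠ 3) : ¬ LayerRankGEAt W 2 2 3 :=
  fun hrk ↦ hl (lam_eq_three_of_road_of_layerRankGEAt_two_three W h17 hGZK hord hf ha hodd hΔ hr hG hμ hsym hrk)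

end Summit.BirchSwinnertonDyer.BirchSwinnertonDyer.Theorems.AlignedTransportAtTwoCyclotomicLayerRoad
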